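import Summits.QuantumFields.BalabanUV.Beta.GAN24.CombContactGaugeStaircase

/-!
# `BalabanUV.Beta.GAN24.CombContactGaugeStaircaseMerged` — row G-an2-4 ∕ (CONV-C), TRANSFER-III, the (III′) S-slot (b): **THE CONJUGATED BOND GAUGE FUNCTION AS A
# STAIRCASE OF THE LEGS' OWN DEPTH** — leaf-01 g89's `(k+2)`-staircase `λ′ μ z u = Σ_{s < k+2} G′ s (blk (Lc^s) u)` (`CombContactGaugeStaircase.combGauge_eq_staircase`) with its top
# (face) piece FOLDED into scale `k` (`blk Lc ∘ blk (Lc^k) = blk (Lc^{k+1})`): `λ′ μ z u = Σ_{s < k+1} G″ s (blk (Lc^s) u)`, `|G″ s (blk (Lc^s) u)| ≤ α₁·(1+Lc)·Lc^s·e^{−κ₀‖quo (Lc^{k+1}) u − z‖∞}`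
# (`s ≤ k`) — EXACTLY the `(hψ, hG)` letter pair of leaf-02's `ContactLambdaEntryBound.abs_contact_entry_le` ∕ leaf-03's (B2) `ContactBorderEntryBound.abs_contact_border_fm_le`
# at `n := k` (staircase depth = number of levels of the legs `legChain _ m k`, relative blocking `Lc^{k+1}`), for the born-Λ AND the born-V comb leg halves alike
# (OWNER `b2b-balaban-gan24-p1` gen 55; leaf-01 g90's ONLINE l.68041 plan «MERGED to depth k+1, α₀ ↦ α₁(1+Lc)» typed once, standalone, so that `CombBornLambdaContactLineage` (leaf-01)
# and `CombBornBorderContactLineage` (memo `HCV-DESIGN-g55.md` (V-C2′)) both `obtain ⟨G, hψ, hG⟩` from it)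

NOT IN PRINT — OUR BOOKKEEPING ([folklore] finite-sum bookkeeping; §1 generic `d`, table-free, leg-free; §2 `d = 3` over leaf-01 g89's `combGauge_eq_staircase ∕ abs_combGaugePiece_le`
with its letters (leaf-12's (N1) data `κ₀, C`, a face letter `F ≥ faceWtSum r Lc`) DISPLAYED as there; 0 `def`, 0 cited fact, 0 `def … : Prop`, 0 sorry; NO estimate of Bałaban's).
HONEST FRAMING (cell contract, verbatim): «discharging `BetaPertH` makes Bałaban's UV stability UNCONDITIONAL — a real constructive-QFT result; it is NOT the continuum limit
and NOT the Clay problem.»  HONEST DEPENDENCY (verbatim): «continuum YM on T⁴ ⇐ BetaPertH ∧ nine spine estimates (0/9 proved); BetaPertH ⇐ (D1) ∧ (D4) ∧ CAP+tail; G-an2-4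
gates asym, D1 and NE2/3/4.»  Discharges NO letter; NEVER «G-an2-4 closed» as (CONV-C); NOT D1, NOT BetaPertH, NOT continuum, NOT Clay.  2026-08-28; no existing file touched.

## What is proved
* §1 (generic `d`, any `G : ℕ → Site (d+1) → ℝ`) `sum_range_succ_eq_sum_range_mergeTop` — `Σ_{s < k+2} G s (blk (Lc^s) u) = Σ_{s < k+1} G″ s (blk (Lc^s) u)` with the merged family
  written inline `G″ s y := G s y + (if s = k then G (k+1) (blk Lc y) else 0)`; `abs_mergeTop_le` — if `|G s (blk (Lc^s) u)| ≤ α·Lc^s·E u` for all `s ≤ k+1` and all `u`, then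
  `|G″ s (blk (Lc^s) u)| ≤ (α·(1+Lc))·Lc^s·E u` for `s ≤ k` (`1 ≤ Lc`, `0 ≤ α`, `0 ≤ E`).
* §2 (`d = 3`, leaf-01 g89's letters displayed) **`exists_combGauge_staircase_merged (m k)`**: `∃ G, (∀ μ z u, λ′ m k μ z u = Σ_{s ∈ range (k+1)} G μ z s (blk (Lc^s) u)) ∧
  (∀ μ z s, s ≤ k → ∀ u, |G μ z s (blk (Lc^s) u)| ≤ (α₁·(1+Lc))·Lc^s·e^{−κ₀‖quo (Lc^{k+1}) u − z‖∞})`, `α₁ = 8LcC(Lc^{5(k+1)})⁻¹ + F·(1+8Lc(e^{κ₀}+1))·C·(Lc^{5(k+1)})⁻¹`,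
  `λ′ m k μ z u = Psi ρ Lc m k (delta1 μ z) u + PsiFace r ρ Lc m k (delta1 μ z) u − bmGaugeAt ρ (respStep (Lc^m) (Lc^(m+k+1)) μ z) Lc u` (`ρ = toSite rr`).
-/

noncomputable section

open Finset
open scoped BigOperators
open Literature.MathematicalPhysics.QuantumFieldTheory
open Literature.MathematicalPhysics.QuantumFieldTheory.LatticeForm (quo)
open Literature.MathematicalPhysics.QuantumFieldTheory.Balaban1983to89
open Literature.MathematicalPhysics.QuantumFieldTheory.Balaban1983to89.Beta
open B4ContourShift (supNorm supNorm_nonneg)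
open AffineAveraging (Site box toSite)
open AveragingContours (blk)
open KKTFluctuationKernel (delta1)
open BalabanCompositeJets (respStep)
open Summit.QuantumFields.BalabanUV.Beta.AxialProjectorBlockMean (bmGaugeAt)
open Summit.QuantumFields.BalabanUV.Beta.SymCorrectorForms (zetaS)
open Summit.QuantumFields.BalabanUV.Beta.SymCorrectorFace (faceWtSum faceWtSum_nonneg)
open Summit.QuantumFields.BalabanUV.Beta.GAN24.Push4Iter (legChain)
open Summit.QuantumFields.BalabanUV.Beta.GAN24.RespStepBmDecompLegs (legAct)
open Summit.QuantumFields.BalabanUV.Beta.GAN24.RespStepBmDecompExact (respStepBmSeq blk_blk_pow)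
open Summit.QuantumFields.BalabanUV.Beta.GAN24.RespStepBmDecompPsi (Psi)
open Summit.QuantumFields.BalabanUV.Beta.GAN24.CombLegChainGauge (PsiFace)
open Summit.QuantumFields.BalabanUV.Beta.GAN24.CombContactGaugeStaircase (combGauge_eq_staircase abs_combGaugePiece_le)

namespace Summit.QuantumFields.BalabanUV.Beta.GAN24.CombContactGaugeStaircaseMerged

variable {d : ℕ} {Lc : ℕ}

/-! ## §1 Folding the top piece of a staircase into the scale below (generic `d`) -/

/-- [folklore] **FOLDING THE TOP PIECE**: `Σ_{s < k+2} G s (blk (Lc^s) u) = Σ_{s < k+1} G″ s (blk (Lc^s) u)`, `G″ s y := G s y + (if s = k then G (k+1) (blk Lc y) else 0)`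
(`blk Lc (blk (Lc^k) u) = blk (Lc^{k+1}) u`, leaf-01's `blk_blk_pow`). -/
theorem sum_range_succ_eq_sum_range_mergeTop (G : ℕ → Site (d + 1) → ℝ) (k : ℕ) (u : Site (d + 1)) :
    ∑ s ∈ Finset.range (k + 1 + 1), G s (blk (Lc ^ s) u)
      = ∑ s ∈ Finset.range (k + 1), (fun (s : ℕ) (y : Site (d + 1)) => G s y + (if s = k then G (k + 1) (blk Lc y) else 0)) s (blk (Lc ^ s) u) := by
  rw [Finset.sum_range_succ _ (k + 1)]
  simp only [Finset.sum_add_distrib]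
  congr 1
  rw [Finset.sum_ite_eq' (Finset.range (k + 1)) k (fun s => G (k + 1) (blk Lc (blk (Lc ^ s) u))), if_pos (Finset.mem_range.2 (Nat.lt_succ_self k)),
    blk_blk_pow]

/-- [folklore] **THE FOLDED PIECES KEEP THE GEOMETRIC LETTER, WITH `α ↦ α·(1+Lc)`**: if `|G s (blk (Lc^s) u)| ≤ α·Lc^s·E u` for all `s ≤ k+1` and all `u` (`1 ≤ Lc`, `0 ≤ α`,
`0 ≤ E`), then `|G″ s (blk (Lc^s) u)| ≤ (α·(1+Lc))·Lc^s·E u` for all `s ≤ k`. -/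
theorem abs_mergeTop_le (hLc : 1 ≤ Lc) {G : ℕ → Site (d + 1) → ℝ} {k : ℕ} {α : ℝ} (hα : 0 ≤ α) {E : Site (d + 1) → ℝ} (hE : ∀ u, 0 ≤ E u)
    (hG : ∀ s, s ≤ k + 1 → ∀ u, |G s (blk (Lc ^ s) u)| ≤ α * (Lc : ℝ) ^ s * E u) {s : ℕ} (hs : s ≤ k) (u : Site (d + 1)) :
    |(fun (s : ℕ) (y : Site (d + 1)) => G s y + (if s = k then G (k + 1) (blk Lc y) else 0)) s (blk (Lc ^ s) u)|
      ≤ α * (1 + (Lc : ℝ)) * (Lc : ℝ) ^ s * E u := by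
  have hL1 : (1 : ℝ) ≤ Lc := by exact_mod_cast hLc
  have hLs : 0 ≤ (Lc : ℝ) ^ s := by positivity
  have h1 := hG s (by omega) u
  by_cases hsk : s = k
  · subst hsk
    dsimp only
    rw [if_pos rfl, blk_blk_pow]
    have h2 := hG (s + 1) le_rfl u
    calc |G s (blk (Lc ^ s) u) + G (s + 1) (blk (Lc ^ (s + 1)) u)|
        ≤ α * (Lc : ℝ) ^ s * E u + α * (Lc : ℝ) ^ (s + 1) * E u := (abs_add_le _ _).trans (add_le_add h1 h2)
      _ = α * (1 + (Lc : ℝ)) * (Lc : ℝ) ^ s * E u := by ring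
  · dsimp only
    rw [if_neg hsk, add_zero]
    calc |G s (blk (Lc ^ s) u)| ≤ α * (Lc : ℝ) ^ s * E u := h1
      _ = α * 1 * (Lc : ℝ) ^ s * E u := by ring
      _ ≤ α * (1 + (Lc : ℝ)) * (Lc : ℝ) ^ s * E u := by
          have h0 : 0 ≤ (Lc : ℝ) := by positivity
          have : α * 1 ≤ α * (1 + (Lc : ℝ)) := mul_le_mul_of_nonneg_left (by linarith) hα
          exact mul_le_mul_of_nonneg_right (mul_le_mul_of_nonneg_right this hLs) (hE u)

/-! ## §2 `d = 3`: the conjugated gauge function as a staircase of the legs' own depth, with leaf-01 g89's letters -/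

section Four

variable [NeZero Lc] {κ₀ C F : ℝ} (hκ : 0 ≤ κ₀) (hC : 0 ≤ C)
  (hN1 : ∀ (m k : ℕ) (μ : Fin (3 + 1)) (z : Site (3 + 1)) (l'' : Fin (3 + 1)) (w' : Site (3 + 1)),
    |respStep (d := 3) (Lc ^ m) (Lc ^ (m + k + 1)) μ z l'' w'| ≤
      C * ((Lc : ℝ) ^ (5 * (k + 1)))⁻¹ * Real.exp (-(κ₀ * supNorm (quo (Lc ^ (k + 1)) w' - z))))
  {r : Fin (3 + 1) → ℕ} (hr : r ∈ box (3 + 1) Lc) {rr : Fin (3 + 1) → ℕ} (hrr : rr ∈ box (3 + 1) Lc) (hF : faceWtSum r Lc ≤ F)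
include hκ hC hN1 hr hrr hF

/-- NOT IN PRINT; OUR BOOKKEEPING.  **THE CONJUGATED BOND GAUGE FUNCTION IS A STAIRCASE OF THE LEGS' OWN DEPTH `k+1` WITH GEOMETRIC PIECES** (`d = 3`, in-block roots
`r, rr`, every `m k`): `∃ G, (∀ μ z u, λ′ μ z u = Σ_{s ∈ range (k+1)} G μ z s (blk (Lc^s) u)) ∧ (∀ μ z s, s ≤ k → ∀ u, |G μ z s (blk (Lc^s) u)| ≤ (α₁·(1+Lc))·Lc^s·e^{−κ₀‖quo (Lc^{k+1}) u − z‖∞})`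
— leaf-01 g89's `combGauge_eq_staircase` ∕ `abs_combGaugePiece_le` with the top (face) piece folded into scale `k` (§1).  This is the `(hψ, hG)` pair of leaf-02's
`ContactLambdaEntryBound.abs_contact_entry_le` and of leaf-03's `ContactBorderEntryBound.abs_contact_border_fm_le` at `n := k`, `αg := α₁·(1+Lc)`, `κ := κ₀`. -/
theorem exists_combGauge_staircase_merged (m k : ℕ) :
    ∃ G : Fin (3 + 1) → Site (3 + 1) → ℕ → Site (3 + 1) → ℝ,
      (∀ (μ : Fin (3 + 1)) (z u : Site (3 + 1)),
        Psi (toSite rr) Lc m k (delta1 μ z) u + PsiFace r (toSite rr) Lc m k (delta1 μ z) u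
            - bmGaugeAt (toSite rr) (respStep (d := 3) (Lc ^ m) (Lc ^ (m + k + 1)) μ z) Lc u
          = ∑ s ∈ Finset.range (k + 1), G μ z s (blk (Lc ^ s) u)) ∧
      (∀ (μ : Fin (3 + 1)) (z : Site (3 + 1)) (s : ℕ), s ≤ k → ∀ u : Site (3 + 1),
        |G μ z s (blk (Lc ^ s) u)|
          ≤ ((8 * (Lc : ℝ) * C * ((Lc : ℝ) ^ (5 * (k + 1)))⁻¹ + F * ((1 + 8 * (Lc : ℝ) * (Real.exp κ₀ + 1)) * C * ((Lc : ℝ) ^ (5 * (k + 1)))⁻¹))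
              * (1 + (Lc : ℝ))) * (Lc : ℝ) ^ s * Real.exp (-(κ₀ * supNorm (quo (Lc ^ (k + 1)) u - z)))) := by
  have hLc : 1 ≤ Lc := Nat.one_le_iff_ne_zero.2 (NeZero.ne Lc)
  have hF0 : 0 ≤ F := (faceWtSum_nonneg r Lc).trans hF
  -- leaf-01 g89's `(k+2)`-staircase pieces, as a family in `μ z`
  let G' : Fin (3 + 1) → Site (3 + 1) → ℕ → Site (3 + 1) → ℝ := fun μ z s y =>
    (if s ≤ k then
        (if s = 0 then -bmGaugeAt (toSite rr) (respStep (d := 3) (Lc ^ m) (Lc ^ (m + k + 1)) μ z) Lc y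
         else -(((Lc : ℝ) ^ ((3 + 1) * s))⁻¹ *
           bmGaugeAt (toSite rr) (legAct (respStep (d := 3) (Lc ^ (m + s)) (Lc ^ (m + k + 1))) (delta1 μ z)) Lc y))
      else 0)
    + (if s = 0 then 0
       else ((Lc : ℝ) ^ ((3 + 1) * (s - 1)))⁻¹ * ((((box (3 + 1) Lc).card : ℝ))⁻¹ *
         zetaS (toSite r) Lc (legAct (legChain (respStepBmSeq (d := 3) (toSite rr) Lc) (m + (s - 1)) (k - (s - 1))) (delta1 μ z)) y))
  refine ⟨fun μ z s y => G' μ z s y + (if s = k then G' μ z (k + 1) (blk Lc y) else 0), fun μ z u => ?_, fun μ z s hs u => ?_⟩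
  · rw [combGauge_eq_staircase r (toSite rr) m k μ z u]
    exact sum_range_succ_eq_sum_range_mergeTop (G' μ z) k u
  · have hpiece : ∀ s, s ≤ k + 1 → ∀ u : Site (3 + 1), |G' μ z s (blk (Lc ^ s) u)|
        ≤ (8 * (Lc : ℝ) * C * ((Lc : ℝ) ^ (5 * (k + 1)))⁻¹ + F * ((1 + 8 * (Lc : ℝ) * (Real.exp κ₀ + 1)) * C * ((Lc : ℝ) ^ (5 * (k + 1)))⁻¹))
            * (Lc : ℝ) ^ s * Real.exp (-(κ₀ * supNorm (quo (Lc ^ (k + 1)) u - z))) :=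
      fun s hs u => abs_combGaugePiece_le hκ hC hN1 hr hrr hF m k μ z hs u
    exact abs_mergeTop_le hLc (by positivity) (fun u => (Real.exp_pos _).le) hpiece hs u

end Four

end Summit.QuantumFields.BalabanUV.Beta.GAN24.CombContactGaugeStaircaseMerged

end
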